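import Summits.AtomisticToContinuum.Crystallization.Theorems.ChartedZeroExcessLayeredLatticeLiouvilleZC

/-!
# Part ZF «ShellLabel» (lens-2 g77 rider 3; step (L1) of the (GL) plan, memo §6 / critic row 1383 (ii))

METRIC → COMBINATORIAL on the mutual-`ε` shell.  For a door set `S` and a cool shadow crystal `C = placedCrystal L′ w′ U t`
(`IsCoolShadowCrystal`, REG-out clause), the `ε`-partner map is ALREADY a bond label of the SHELL `{p ∈ S | ∀ k ∈ K, r < dist p k}`:
★ `shell_bondLabel : ∃ lab, IsBondLabel ε r ℓ {p | p ∈ S ∧ ∀ k ∈ K, r < dist p k} K (placedCrystal L′ w′ U t) lab` under the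
numeric side conditions `aHi ≤ 1`, `ε ≤ 1/40` (record: `ε = 10⁻⁴`).  Ingredients: `door_min_dist` (two atoms of a door set are
`≥ 27/32` apart — the clean windows at `a ≥ 9/10`), tree `door_bond_iff` (a bond has `dist ≤ 17/16·aHi`), the triangle inequality
(`17/16 + 2ε ≤ 28/25`, `27/32 − 2ε > 0`).  So (GL) `BondLabelP` = «extend a bond label from the shell `S_r` to `S` on the `ℓ`-zone»;
the extension is the sheet-by-sheet continuation of riders ZD (`lattice_rigidity`) and ZE (`sheet_lift`) through the chart of
`IsCharted` (memo §6 (L2), (L4)).  0 sorry; standard axioms.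
-/

noncomputable section
open scoped BigOperators Classical InnerProductSpace RealInnerProductSpace
open MeasureTheory Set Metric Filter Topology
open Summit.AtomisticToContinuum.Crystallization.Theorems.ChartedPlanarOrderRigidityDoor (E3 IsClean IsCharted)
open Summit.AtomisticToContinuum.Crystallization.Theorems.ChartedPlanarOrderDensityDichotomy (μS IsSep)
open Summit.AtomisticToContinuum.Crystallization.Theorems.ChartedPlanarOrderCleanScaleP (IsCleanP IsDoorSetP)
open Summit.AtomisticToContinuum.Crystallization.Theorems.ChartedPlanarOrderMesoCut (LayeredHom EnvClose)
open Literature.Geometry.DiscreteGeometry (IsTwoShellGoodSet)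

namespace Summit.AtomisticToContinuum.Crystallization.Theorems.ChartedZeroExcessLayeredLatticeLiouville

/-! ### ZF-1  The hard core of a door set -/

/-- **Two atoms of a door set are at least `27/32` apart** (clean windows `|d − a| ≤ a/16` or `|d − √2·a| ≤ a/16` within `3a/2`,
at `a ≥ 9/10`; beyond `3a/2 ≥ 27/20` trivially). -/
theorem door_min_dist {aHi δ : ℝ} {S : Set E3} (hS : IsDoorSetP aHi δ S) {p q : E3} (hp : p ∈ S) (hq : q ∈ S)
    (hne : p ≠ q) : 27 / 32 ≤ dist p q := by
  obtain ⟨a, ha₁, _, hwin⟩ := windows_of_isTwoShellGoodSet (by norm_num) (isTwoShellGoodSet_of_isDoorSetP hS hq)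
  by_cases hfar : dist p q ≤ 3 / 2 * a
  · rcases hwin p hp hne hfar with h | h
    · have := (abs_le.1 h).1
      nlinarith
    · have := (abs_le.1 h).1
      nlinarith [sqrt_two_window.1]
  · push Not at hfar
    nlinarith

/-! ### ZF-2  ★ The ε-partner map is a bond label of the shell -/

/-- ★ **SHELL BOND LABEL ((GL) on the shell, PROVED).**  Under `aHi ≤ 1` and `ε ≤ 1/40`, for a door set `S` and a cool shadow crystal
the REG-out `ε`-partners form a bond label of the shell `S_r = {p ∈ S | ∀ k ∈ K, r < dist p k}`: into `C`, bonds ↦ bonds, injective on the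
zone, `ε`-close.  (No use of the separation `σ` of `C`, of the shadow clause, or of REG-in.) -/
theorem shell_bondLabel {aHi δ σ ϑr Rs ε r rI ℓ : ℝ} {S K H : Set E3} {L' : E3 →L[ℝ] E3} {w' : ℤ → E3} {U : E3 ≃ₗᵢ[ℝ] E3} {t : E3}
    (haHi : aHi ≤ 1) (hS : IsDoorSetP aHi δ S) (hε : ε ≤ 1 / 40)
    (hC : IsCoolShadowCrystal σ ϑr Rs ε r rI ℓ S K H L' w' U t) :
    ∃ lab : E3 → E3, IsBondLabel ε r ℓ {p | p ∈ S ∧ ∀ k ∈ K, r < dist p k} K (placedCrystal L' w' U t) lab := by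
  obtain ⟨-, -, -, hout, -⟩ := hC
  -- the partner map (junk value `p` off the shell zone)
  have hch : ∀ p : E3, ∃ c : E3, (p ∈ S → (∃ k ∈ K, dist p k < ℓ) → (∀ k ∈ K, r < dist p k) →
      c ∈ placedCrystal L' w' U t ∧ dist p c ≤ ε) := by
    intro p
    by_cases h : p ∈ S ∧ (∃ k ∈ K, dist p k < ℓ) ∧ ∀ k ∈ K, r < dist p k
    · obtain ⟨c, hc, hpc⟩ := hout p h.1 h.2.1 h.2.2
      exact ⟨c, fun _ _ _ => ⟨hc, hpc⟩⟩
    · exact ⟨p, fun h1 h2 h3 => absurd ⟨h1, h2, h3⟩ h⟩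
  choose lab hlab using hch
  refine ⟨lab, ?_, ?_, ?_, ?_⟩
  · rintro p ⟨hpS, hpr⟩ hpl
    exact (hlab p hpS hpl hpr).1
  · rintro p ⟨hpS, hpr⟩ p' ⟨hp'S, hp'r⟩ hpl hp'l ⟨hpos, hle⟩
    obtain ⟨-, hpc⟩ := hlab p hpS hpl hpr
    obtain ⟨-, hp'c'⟩ := hlab p' hp'S hp'l hp'r
    have hne : p ≠ p' := by
      rintro rfl
      rw [dist_self] at hpos
      exact lt_irrefl _ hpos
    have hmin := door_min_dist hS hpS hp'S hne
    have hbond : dist p p' ≤ 17 / 16 * aHi := (door_bond_iff haHi hS hpS hp'S).1 hle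
    have tri₁ : dist (lab p) (lab p') ≤ dist (lab p) p + dist p p' + dist p' (lab p') := dist_triangle4 _ _ _ _
    have tri₂ : dist p p' ≤ dist p (lab p) + dist (lab p) (lab p') + dist (lab p') p' := dist_triangle4 _ _ _ _
    rw [dist_comm (lab p) p] at tri₁
    rw [dist_comm (lab p') p'] at tri₂
    have h9 := le_ceiling_of_isDoorSetP hS
    refine ⟨by linarith, by nlinarith⟩
  · rintro p ⟨⟨hpS, hpr⟩, hpl⟩ p' ⟨⟨hp'S, hp'r⟩, hp'l⟩ heq
    by_contra hne
    obtain ⟨-, hpc⟩ := hlab p hpS hpl hpr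
    obtain ⟨-, hp'c'⟩ := hlab p' hp'S hp'l hp'r
    have hmin := door_min_dist hS hpS hp'S hne
    have h0 : dist (lab p) (lab p') = 0 := by rw [heq, dist_self]
    have tri₂ : dist p p' ≤ dist p (lab p) + dist (lab p) (lab p') + dist (lab p') p' := dist_triangle4 _ _ _ _
    rw [dist_comm (lab p') p'] at tri₂
    linarith
  · rintro p ⟨hpS, hpr⟩ hpl -
    exact (hlab p hpS hpl hpr).2

/-- the record instance (`aHi ≤ 1` from the binders' regime, `ε = 10⁻⁴`). -/
theorem shell_bondLabel_record {aHi δ r rI ℓ : ℝ} {S K H : Set E3} {L' : E3 →L[ℝ] E3} {w' : ℤ → E3} {U : E3 ≃ₗᵢ[ℝ] E3} {t : E3}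
    (haHi : aHi ≤ 1) (hS : IsDoorSetP aHi δ S)
    (hC : IsCoolShadowCrystal (17 / 20) (1 / 10000) 5 (1 / 10000) r rI ℓ S K H L' w' U t) :
    ∃ lab : E3 → E3, IsBondLabel (1 / 10000) r ℓ {p | p ∈ S ∧ ∀ k ∈ K, r < dist p k} K (placedCrystal L' w' U t) lab :=
  shell_bondLabel haHi hS (by norm_num) hC

end Summit.AtomisticToContinuum.Crystallization.Theorems.ChartedZeroExcessLayeredLatticeLiouville
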